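import Literature.NumberTheory.GaloisRepresentations.ContinuousCohomologyRestrictScalars
import Literature.NumberTheory.GaloisRepresentations.ContinuousCohomologyVanishing
import HarnessLib

/-!
# Continuous cohomology does not see the ring of scalars — all degrees, as an isomorphism

Topic `NumberTheory/GaloisRepresentations` (continuous cochain cohomology; Mathlib's
`continuousCohomology`); namespace `Literature.NumberTheory.GaloisRepresentations`. Definitions
with bodies (explicit comparison isomorphisms) and theorems; no named fact, no `sorry`, no
instance, no notation.

Let `G` be a topological group and let `X : TopRep k₁ G`, `Y : TopRep k₂ G` be topological
representations over two (possibly different) topological rings of coefficients whose underlying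
topological `G`-modules are identified: a continuous additive equivalence `η : X ≃ₜ+ Y` with
`η (g • x) = g • η x`. Mathlib's continuous cohomology `continuousCohomology n X : TopModuleCat k₁`
is the homology of the complex of `G`-invariant homogeneous cochains
`X → C(G, X) → C(G, C(G, X)) → ⋯` (`TopRep.resolutionX`, `TopRep.d`), all of whose terms,
differentials and `G`-actions are built from the topological additive group `X` and the action
alone. This file makes that remark a theorem in every degree:

* `resolutionEquiv η hη m : resolutionX X m ≃ₜ+ resolutionX Y m` — postcomposition with `η`,
  level by level (`§1`); it is `G`-equivariant (`resolutionEquiv_ρ`) and commutes with the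
  differentials (`resolutionEquiv_d`);
* `cochainsEquiv η hη n : (homogeneousCochains X).X n ≃+ (homogeneousCochains Y).X n` — its
  restriction to invariant cochains, commuting with the differentials of the two complexes
  (`cochainsEquiv_d`, `§2`);
* `homologyAddEquivOfCompatible` (`§3`, any two cochain complexes of topological modules over two
  rings, indexed by `ℕ`, whose terms are identified by additive equivalences commuting with `d`):
  `Hⁿ(K) ≃+ Hⁿ(L)`, built on the tree's explicit classes `cxClass` (`ContinuousH1.lean`) — the
  class maps `Zⁿ → Hⁿ` are surjective with kernel the coboundaries on both sides, so the
  identification of cocycles and coboundaries descends (`AddMonoidHom.liftOfSurjective`);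
* `continuousCohomologyAddEquiv η hη n : continuousCohomology n X ≃+ continuousCohomology n Y`
  (`§4`), with its value on classes (`continuousCohomologyAddEquiv_cxClass`);
* naturality (`§6`): the identifications commute with Mathlib's functoriality maps
  `ContinuousCohomology.map φ f` (`continuousCohomologyAddEquiv_map`; `ContinuousRep.restrictScalarsH_Hpullback`:
  restriction of scalars commutes with restriction to a subgroup / pull-back);
* corollaries (`§5`): `ContinuousRep.restrictScalarsH (ρ) (P) (n) : (ρ.restrictScalars P).H n ≃+ ρ.H n`
  — the all-degree form of the TODO recorded in `ContinuousCohomologyRestrictScalars.lean`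
  ("all degrees `n`, and the comparison `Hⁿ(G, M|_P) ≃+ Hⁿ(G, M)` itself") — and
  `ContinuousRep.HAddEquivOfContinuousAddEquiv` for two continuous representations over two rings
  on continuously-additively isomorphic modules with matching actions.

This is the continuous analogue, in all degrees and in isomorphism form, of the tree's
`Literature.Algebra.Homology.GroupCohomologyRestrictScalars` ("group cohomology does not see the
scalars", Brown III.1 Ex. 3); the vanishing-only, degree `≤ 2` predecessor is
`ContinuousCohomologyRestrictScalars.lean`. Consumer: the discharge of Greenberg 2006 Thm. 3
(`IwasawaTheory/Greenberg2006/InducedCohomologyComparisonHolds.lean`), where the two sides of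
Shapiro's lemma are typed over `Λ₂ = 𝒪⟦T₁,T₂⟧`, resp. `𝒪`, while Serre's induced module lives
over `ℤ`.

## References
* K. S. Brown, *Cohomology of Groups* (1982), III.1 Example 3 (the standard cochain complex does
  not involve the ring of scalars). [Brown1982CohomologyGroups]
* J.-P. Serre, *Galois Cohomology* (1997), I §2.2 (continuous cochains). [SerreGaloisCohomology1997]
-/

noncomputable section

open CategoryTheory

namespace Literature.NumberTheory.GaloisRepresentations

universe u u' v

set_option allowUnsafeReducibility true in
attribute [local reducible] CategoryTheory.Functor.mapHomologicalComplex

/-! ## §0. Postcomposition with a continuous additive equivalence -/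

section Postcomp

variable (G : Type v) [TopologicalSpace G] {V : Type*} {W : Type*} [TopologicalSpace V]
  [TopologicalSpace W] [Add V] [Add W] [ContinuousAdd V] [ContinuousAdd W]

/-- Postcomposition with a continuous additive equivalence `e : V ≃ₜ+ W` is a continuous additive
equivalence `C(G, V) ≃ₜ+ C(G, W)` (compact-open topologies). [folklore] -/
def ContinuousAddEquiv.continuousMapPostcomp (e : V ≃ₜ+ W) : C(G, V) ≃ₜ+ C(G, W) where
  toFun f := (⟨e, e.continuous⟩ : C(V, W)).comp f
  invFun f := (⟨e.symm, e.symm.continuous⟩ : C(W, V)).comp f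
  left_inv f := by ext x; exact e.symm_apply_apply (f x)
  right_inv f := by ext x; exact e.apply_symm_apply (f x)
  map_add' f f' := by ext x; exact map_add e (f x) (f' x)
  continuous_toFun := ContinuousMap.continuous_postcomp _
  continuous_invFun := ContinuousMap.continuous_postcomp _

/-- Unfolding `continuousMapPostcomp`: `(e ∘ f)(x) = e (f x)`. [cite: SerreGaloisCohomology1997, I §2.2 (continuous homogeneous cochains, H^q = Z^q/B^q)] -/
@[simp] theorem ContinuousAddEquiv.continuousMapPostcomp_apply_apply (e : V ≃ₜ+ W) (f : C(G, V))
    (x : G) : ContinuousAddEquiv.continuousMapPostcomp G e f x = e (f x) := rfl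

end Postcomp

/-! ## §1. The standard resolutions of `X` and `Y` are identified, equivariantly and compatibly
with `d` -/

section Resolution

variable {k₁ : Type u} [Ring k₁] [TopologicalSpace k₁] {k₂ : Type u'} [Ring k₂] [TopologicalSpace k₂]
variable {G : Type v} [Group G] [TopologicalSpace G] [IsTopologicalGroup G]
variable {X : TopRep.{v} k₁ G} {Y : TopRep.{v} k₂ G}
variable (η : (X : Type v) ≃ₜ+ (Y : Type v)) (hη : ∀ (g : G) (x : X), η (X.ρ g x) = Y.ρ g (η x))

open TopRep ContRepresentation

/-- **Level-`m` identification of the standard resolutions** `resolutionX X m ≃ₜ+ resolutionX Y m`: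
`η` in level `0`, and postcomposition with the previous level on `C(G, ·)`. [cite: SerreGaloisCohomology1997, I §2.2 (continuous homogeneous cochains, H^q = Z^q/B^q)] -/
def resolutionEquiv : (m : ℕ) → ((resolutionX X m : Type v) ≃ₜ+ (resolutionX Y m : Type v))
  | 0 => η
  | m + 1 => ContinuousAddEquiv.continuousMapPostcomp G (resolutionEquiv m)

/-- Unfolding in level `0`. [cite: SerreGaloisCohomology1997, I §2.2 (continuous homogeneous cochains, H^q = Z^q/B^q)] -/
@[simp] theorem resolutionEquiv_zero (x : X) : resolutionEquiv η 0 x = η x := rfl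

/-- Unfolding in level `m + 1`: `(resolutionEquiv (m+1) f)(x) = resolutionEquiv m (f x)`. [cite: SerreGaloisCohomology1997, I §2.2 (continuous homogeneous cochains, H^q = Z^q/B^q)] -/
@[simp] theorem resolutionEquiv_succ_apply (m : ℕ) (f : (resolutionX X (m + 1) : Type v)) (x : G) :
    (resolutionEquiv η (m + 1) f : (resolutionX Y (m + 1) : Type v)) x = resolutionEquiv η m (f x) :=
  rfl

include hη in
/-- **Equivariance** of the identifications: `η_m (g • f) = g • η_m f` in every level (the action
on `C(G, V)` is `(g • f)(x) = g • f(g⁻¹ x)`, Mathlib `ContRepresentation.coind₁`). [cite: SerreGaloisCohomology1997, I §2.2 (continuous homogeneous cochains, H^q = Z^q/B^q)] -/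
theorem resolutionEquiv_ρ : ∀ (m : ℕ) (g : G) (f : (resolutionX X m : Type v)),
    resolutionEquiv η m ((resolutionX X m).ρ g f) = (resolutionX Y m).ρ g (resolutionEquiv η m f)
  | 0, g, f => hη g f
  | m + 1, g, f => by
    refine ContinuousMap.ext fun x => ?_
    change resolutionEquiv η m ((resolutionX X m).ρ g (f (g⁻¹ * x))) =
      (resolutionX Y m).ρ g (resolutionEquiv η m (f (g⁻¹ * x)))
    exact resolutionEquiv_ρ m g _

/-- **Compatibility with the differentials**: `η_{m+1} (d f) = d (η_m f)` in every level
(`d₀ = const`, `d_{m+1} f = const f − d_m ∘ f`, Mathlib `TopRep.d`). [cite: SerreGaloisCohomology1997, I §2.2 (continuous homogeneous cochains, H^q = Z^q/B^q)] -/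
theorem resolutionEquiv_d : ∀ (m : ℕ) (f : (resolutionX X m : Type v)),
    resolutionEquiv η (m + 1) ((TopRep.d X m).hom f) = (TopRep.d Y m).hom (resolutionEquiv η m f)
  | 0, f => by
    ext x
    rfl
  | m + 1, f => by
    refine ContinuousMap.ext fun x => ?_
    change resolutionEquiv η (m + 1) (f - (TopRep.d X m).hom (f x)) =
      resolutionEquiv η (m + 1) f - (TopRep.d Y m).hom (resolutionEquiv η (m + 1) f x)
    rw [map_sub, resolutionEquiv_succ_apply, resolutionEquiv_d m (f x)]

include hη in
/-- Invariant vectors correspond under the identifications. [cite: SerreGaloisCohomology1997, I §2.2 (continuous homogeneous cochains, H^q = Z^q/B^q)] -/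
theorem resolutionEquiv_mem_invariants_iff (m : ℕ) (f : (resolutionX X m : Type v)) :
    resolutionEquiv η m f ∈ (resolutionX Y m).ρ.invariants ↔ f ∈ (resolutionX X m).ρ.invariants := by
  rw [mem_invariants, mem_invariants]
  constructor
  · intro h g
    apply (resolutionEquiv η m).injective
    rw [resolutionEquiv_ρ η hη m g f, h g]
  · intro h g
    rw [← resolutionEquiv_ρ η hη m g f, h g]

/-! ## §2. Invariant homogeneous cochains are identified, compatibly with `d` -/

/-- **The identification of the complexes of invariant homogeneous cochains, termwise**:
`C(G, …, C(G, X))^G ≃+ C(G, …, C(G, Y))^G` in degree `n` (restriction of `resolutionEquiv (n+1)`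
to invariants). [cite: SerreGaloisCohomology1997, I §2.2 (continuous homogeneous cochains, H^q = Z^q/B^q)] -/
def cochainsEquiv (n : ℕ) :
    ((homogeneousCochains X).X n : Type v) ≃+ ((homogeneousCochains Y).X n : Type v) where
  toFun c := ⟨resolutionEquiv η (n + 1) (c : (resolutionX X (n + 1) : Type v)),
    (resolutionEquiv_mem_invariants_iff η hη (n + 1) _).2 c.2⟩
  invFun c := ⟨(resolutionEquiv η (n + 1)).symm (c : (resolutionX Y (n + 1) : Type v)), by
    rw [← resolutionEquiv_mem_invariants_iff η hη (n + 1), ContinuousAddEquiv.apply_symm_apply]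
    exact c.2⟩
  left_inv c := Subtype.ext ((resolutionEquiv η (n + 1)).symm_apply_apply _)
  right_inv c := Subtype.ext ((resolutionEquiv η (n + 1)).apply_symm_apply _)
  map_add' c c' := Subtype.ext (map_add (resolutionEquiv η (n + 1)) _ _)

/-- Unfolding `cochainsEquiv` on underlying cochains. [cite: SerreGaloisCohomology1997, I §2.2 (continuous homogeneous cochains, H^q = Z^q/B^q)] -/
@[simp] theorem coe_cochainsEquiv (n : ℕ) (c : ((homogeneousCochains X).X n : Type v)) :
    ((cochainsEquiv η hη n c : ((homogeneousCochains Y).X n : Type v)) : (resolutionX Y (n + 1) : Type v)) =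
      resolutionEquiv η (n + 1) (c : (resolutionX X (n + 1) : Type v)) :=
  rfl

/-- **The identifications commute with the differentials of the two cochain complexes.** [cite: SerreGaloisCohomology1997, I §2.2 (continuous homogeneous cochains, H^q = Z^q/B^q)] -/
theorem cochainsEquiv_d (i : ℕ) (c : ((homogeneousCochains X).X i : Type v)) :
    cochainsEquiv η hη (i + 1) ((homogeneousCochains X).d i (i + 1) c) =
      (homogeneousCochains Y).d i (i + 1) (cochainsEquiv η hη i c) := by
  apply Subtype.ext
  change resolutionEquiv η (i + 2)
      ((((homogeneousCochains X).d i (i + 1)).hom c : ((homogeneousCochains X).X (i + 1) : Type v)) :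
        (resolutionX X (i + 2) : Type v)) =
    ((((homogeneousCochains Y).d i (i + 1)).hom (cochainsEquiv η hη i c) :
        ((homogeneousCochains Y).X (i + 1) : Type v)) : (resolutionX Y (i + 2) : Type v))
  rw [homogeneousCochains.d_apply, homogeneousCochains.d_apply]
  exact resolutionEquiv_d η (i + 1) _

end Resolution

/-! ## §3. Homology of complexes of topological modules whose terms are identified additively -/

section Homology

variable {k₁ : Type u} [Ring k₁] [TopologicalSpace k₁] {k₂ : Type u'} [Ring k₂] [TopologicalSpace k₂]

/-- The cocycles `Zⁿ(K) = {x ∈ Kⁿ | d x = 0}` of a cochain complex of topological modules, as an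
additive subgroup. [cite: SerreGaloisCohomology1997, I §2.2 (continuous homogeneous cochains, H^q = Z^q/B^q)] -/
def cocyclesAddSubgroup (K : CochainComplex (TopModuleCat.{v} k₁) ℕ) (n : ℕ) : AddSubgroup (K.X n) where
  carrier := {x | K.d n (n + 1) x = 0}
  zero_mem' := map_zero _
  add_mem' {a b} ha hb := by
    simp only [Set.mem_setOf_eq] at ha hb ⊢
    rw [map_add, ha, hb, add_zero]
  neg_mem' {a} ha := by
    simp only [Set.mem_setOf_eq] at ha ⊢
    rw [map_neg, ha, neg_zero]

/-- Membership in `Zⁿ(K)`. [cite: SerreGaloisCohomology1997, I §2.2 (continuous homogeneous cochains, H^q = Z^q/B^q)] -/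
theorem mem_cocyclesAddSubgroup_iff (K : CochainComplex (TopModuleCat.{v} k₁) ℕ) (n : ℕ) (x : K.X n) :
    x ∈ cocyclesAddSubgroup K n ↔ K.d n (n + 1) x = 0 :=
  Iff.rfl

/-- The class map `Zⁿ(K) → Hⁿ(K)`, `z ↦ [z]` (the tree's `cxClass`), as an additive homomorphism.
[cite: SerreGaloisCohomology1997, I §2.2 (continuous homogeneous cochains, H^q = Z^q/B^q)] -/
def cocycleClassHom (K : CochainComplex (TopModuleCat.{v} k₁) ℕ) (n : ℕ) :
    cocyclesAddSubgroup K n →+ K.homology n where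
  toFun z := cxClass K n (n + 1) (up_nat_next n) z.1 z.2
  map_zero' := (cxClass_eq_zero_iff K n (n + 1) (up_nat_next n) _ rfl 0 (map_zero _)).2 ⟨0, map_zero _⟩
  map_add' a b := cxClass_add K n (n + 1) (up_nat_next n) a.1 b.1 a.2 b.2

/-- Unfolding the class map. [cite: SerreGaloisCohomology1997, I §2.2 (continuous homogeneous cochains, H^q = Z^q/B^q)] -/
theorem cocycleClassHom_apply (K : CochainComplex (TopModuleCat.{v} k₁) ℕ) (n : ℕ)
    (z : cocyclesAddSubgroup K n) :
    cocycleClassHom K n z = cxClass K n (n + 1) (up_nat_next n) z.1 z.2 :=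
  rfl

/-- Every class is the class of a cocycle. [cite: SerreGaloisCohomology1997, I §2.2 (continuous homogeneous cochains, H^q = Z^q/B^q)] -/
theorem cocycleClassHom_surjective (K : CochainComplex (TopModuleCat.{v} k₁) ℕ) (n : ℕ) :
    Function.Surjective (cocycleClassHom K n) := fun γ ↦ by
  obtain ⟨x, hx, rfl⟩ := cxClass_surjective K n (n + 1) (up_nat_next n) γ
  exact ⟨⟨x, hx⟩, rfl⟩

/-- The kernel of the class map consists of the coboundaries (for `n = 0`: of `d : K⁰ → K⁰`, which is
zero, so the class map is injective there). [cite: SerreGaloisCohomology1997, I §2.2 (continuous homogeneous cochains, H^q = Z^q/B^q)] -/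
theorem cocycleClassHom_eq_zero_iff (K : CochainComplex (TopModuleCat.{v} k₁) ℕ) (n : ℕ)
    (z : cocyclesAddSubgroup K n) :
    cocycleClassHom K n z = 0 ↔ ∃ y : K.X ((ComplexShape.up ℕ).prev n), K.d _ n y = z.1 :=
  cxClass_eq_zero_iff K n (n + 1) (up_nat_next n) _ rfl z.1 z.2

variable {K : CochainComplex (TopModuleCat.{v} k₁) ℕ} {L : CochainComplex (TopModuleCat.{v} k₂) ℕ}
  (e : ∀ i, (K.X i : Type v) ≃+ (L.X i : Type v))
  (he : ∀ (i : ℕ) (x : K.X i), e (i + 1) (K.d i (i + 1) x) = L.d i (i + 1) (e i x))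

include he in
/-- Compatibility with ALL differentials `d i j` follows from compatibility with the `d i (i+1)`
(the others vanish). [cite: Brown1982CohomologyGroups, III.1 Example 3 (the standard complex does not involve the scalars)] -/
theorem addEquiv_d_comm (i j : ℕ) (x : K.X i) : e j (K.d i j x) = L.d i j (e i x) := by
  by_cases h : i + 1 = j
  · subst h
    exact he i x
  · rw [K.shape i j h, L.shape i j h]
    change e j ((0 : K.X i ⟶ K.X j).hom x) = (0 : L.X i ⟶ L.X j).hom (e i x)
    rw [TopModuleCat.hom_zero_apply, TopModuleCat.hom_zero_apply, map_zero]

/-- Cocycles correspond under the identifications.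
[cite: Brown1982CohomologyGroups, III.1 Example 3 (the standard complex does not involve the scalars)] -/
def cocyclesEquiv (n : ℕ) : cocyclesAddSubgroup K n ≃+ cocyclesAddSubgroup L n where
  toFun z := ⟨e n z.1, by
    rw [mem_cocyclesAddSubgroup_iff, ← he, (mem_cocyclesAddSubgroup_iff K n z.1).1 z.2, map_zero]⟩
  invFun w := ⟨(e n).symm w.1, by
    rw [mem_cocyclesAddSubgroup_iff]
    apply (e (n + 1)).injective
    rw [he, AddEquiv.apply_symm_apply, (mem_cocyclesAddSubgroup_iff L n w.1).1 w.2, map_zero]⟩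
  left_inv z := Subtype.ext ((e n).symm_apply_apply z.1)
  right_inv w := Subtype.ext ((e n).apply_symm_apply w.1)
  map_add' z z' := Subtype.ext (map_add (e n) z.1 z'.1)

/-- Unfolding `cocyclesEquiv`. [cite: Brown1982CohomologyGroups, III.1 Example 3 (the standard complex does not involve the scalars)] -/
@[simp] theorem coe_cocyclesEquiv (n : ℕ) (z : cocyclesAddSubgroup K n) :
    ((cocyclesEquiv e he n z : cocyclesAddSubgroup L n) : L.X n) = e n z.1 :=
  rfl

include he in
/-- Coboundaries correspond: the class of `z` vanishes iff the class of `e z` does. [cite: Brown1982CohomologyGroups, III.1 Example 3 (the standard complex does not involve the scalars)] -/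
theorem cocycleClassHom_eq_zero_iff_of_addEquiv (n : ℕ) (z : cocyclesAddSubgroup K n) :
    cocycleClassHom K n z = 0 ↔ cocycleClassHom L n (cocyclesEquiv e he n z) = 0 := by
  rw [cocycleClassHom_eq_zero_iff, cocycleClassHom_eq_zero_iff]
  constructor
  · rintro ⟨y, hy⟩
    exact ⟨e _ y, by rw [← addEquiv_d_comm e he, hy]; rfl⟩
  · rintro ⟨y, hy⟩
    refine ⟨(e _).symm y, (e n).injective ?_⟩
    rw [addEquiv_d_comm e he, AddEquiv.apply_symm_apply, hy]
    rfl

/-- The comparison map `Hⁿ(K) → Hⁿ(L)` descended from `z ↦ [e z]` along the surjection `Zⁿ(K) → Hⁿ(K)`.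
[cite: Brown1982CohomologyGroups, III.1 Example 3 (the standard complex does not involve the scalars)] -/
def homologyMapOfCompatible (n : ℕ) : K.homology n →+ L.homology n :=
  (cocycleClassHom K n).liftOfSurjective (cocycleClassHom_surjective K n)
    ⟨(cocycleClassHom L n).comp (cocyclesEquiv e he n).toAddMonoidHom, fun z hz ↦ by
      rw [AddMonoidHom.mem_ker] at hz ⊢
      exact (cocycleClassHom_eq_zero_iff_of_addEquiv e he n z).1 hz⟩

/-- The comparison map on classes: `[z] ↦ [e z]`. [cite: Brown1982CohomologyGroups, III.1 Example 3 (the standard complex does not involve the scalars)] -/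
theorem homologyMapOfCompatible_cocycleClassHom (n : ℕ) (z : cocyclesAddSubgroup K n) :
    homologyMapOfCompatible e he n (cocycleClassHom K n z) =
      cocycleClassHom L n (cocyclesEquiv e he n z) :=
  (cocycleClassHom K n).liftOfRightInverse_comp_apply _ _ _ z

/-- **Cochain complexes of topological modules (over two rings) whose terms are identified by additive
equivalences commuting with `d` have isomorphic homology**, `Hⁿ(K) ≃+ Hⁿ(L)`, `[z] ↦ [e z]`.
[cite: Brown1982CohomologyGroups, III.1 Example 3] -/
def homologyAddEquivOfCompatible (n : ℕ) : K.homology n ≃+ L.homology n where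
  toFun := homologyMapOfCompatible e he n
  invFun := homologyMapOfCompatible (fun i ↦ (e i).symm)
    (fun i x ↦ (e (i + 1)).injective (by rw [AddEquiv.apply_symm_apply, he, AddEquiv.apply_symm_apply])) n
  left_inv γ := by
    obtain ⟨z, rfl⟩ := cocycleClassHom_surjective K n γ
    rw [homologyMapOfCompatible_cocycleClassHom, homologyMapOfCompatible_cocycleClassHom]
    congr 1
    exact Subtype.ext ((e n).symm_apply_apply z.1)
  right_inv γ := by
    obtain ⟨w, rfl⟩ := cocycleClassHom_surjective L n γ
    rw [homologyMapOfCompatible_cocycleClassHom, homologyMapOfCompatible_cocycleClassHom]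
    congr 1
    exact Subtype.ext ((e n).apply_symm_apply w.1)
  map_add' := map_add _

/-- **Value on classes**: `homologyAddEquivOfCompatible e he n [x] = [e x]`. [cite: Brown1982CohomologyGroups, III.1 Example 3 (the standard complex does not involve the scalars)] -/
theorem homologyAddEquivOfCompatible_cxClass (n : ℕ) (x : K.X n) (hx : K.d n (n + 1) x = 0) :
    homologyAddEquivOfCompatible e he n (cxClass K n (n + 1) (up_nat_next n) x hx) =
      cxClass L n (n + 1) (up_nat_next n) (e n x)
        ((mem_cocyclesAddSubgroup_iff L n _).1 (cocyclesEquiv e he n ⟨x, hx⟩).2) :=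
  homologyMapOfCompatible_cocycleClassHom e he n ⟨x, hx⟩

end Homology

/-! ## §4. `Hⁿ(G, X) ≃+ Hⁿ(G, Y)` -/

section Cohomology

variable {k₁ : Type u} [Ring k₁] [TopologicalSpace k₁] {k₂ : Type u'} [Ring k₂] [TopologicalSpace k₂]
variable {G : Type v} [Group G] [TopologicalSpace G] [IsTopologicalGroup G]
variable {X : TopRep.{v} k₁ G} {Y : TopRep.{v} k₂ G}
variable (η : (X : Type v) ≃ₜ+ (Y : Type v)) (hη : ∀ (g : G) (x : X), η (X.ρ g x) = Y.ρ g (η x))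

open TopRep

/-- **Continuous cohomology does not see the ring of scalars, all degrees**: two topological
representations of `G` over two rings of coefficients whose underlying topological `G`-modules are
identified by an equivariant continuous additive equivalence `η` have isomorphic continuous cohomology
groups, `Hⁿ(G, X) ≃+ Hⁿ(G, Y)` for every `n` (on classes: postcompose the homogeneous cocycle with `η`).
[cite: Brown1982CohomologyGroups, III.1 Example 3] [cite: SerreGaloisCohomology1997, I §2.2] -/
def continuousCohomologyAddEquiv (n : ℕ) :
    (continuousCohomology n X : Type v) ≃+ (continuousCohomology n Y : Type v) :=
  homologyAddEquivOfCompatible (cochainsEquiv η hη) (cochainsEquiv_d η hη) n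

/-- Value of `continuousCohomologyAddEquiv` on the class of an invariant homogeneous cocycle.
[cite: Brown1982CohomologyGroups, III.1 Example 3 (the standard complex does not involve the scalars)] -/
theorem continuousCohomologyAddEquiv_cxClass (n : ℕ) (c : ((homogeneousCochains X).X n : Type v))
    (hc : (homogeneousCochains X).d n (n + 1) c = 0) :
    continuousCohomologyAddEquiv η hη n (cxClass (homogeneousCochains X) n (n + 1) (up_nat_next n) c hc) =
      cxClass (homogeneousCochains Y) n (n + 1) (up_nat_next n) (cochainsEquiv η hη n c)
        ((mem_cocyclesAddSubgroup_iff _ n _).1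
          (cocyclesEquiv (cochainsEquiv η hη) (cochainsEquiv_d η hη) n ⟨c, hc⟩).2) :=
  homologyAddEquivOfCompatible_cxClass _ _ n c hc

include η hη in
/-- Vanishing form: `Hⁿ(G, X) = 0 ↔ Hⁿ(G, Y) = 0`. [cite: Brown1982CohomologyGroups, III.1 Example 3 (the standard complex does not involve the scalars)] -/
theorem subsingleton_continuousCohomology_iff_of_continuousAddEquiv (n : ℕ) :
    Subsingleton (continuousCohomology n X) ↔ Subsingleton (continuousCohomology n Y) :=
  ⟨fun _ ↦ (continuousCohomologyAddEquiv η hη n).symm.toEquiv.subsingleton,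
    fun _ ↦ (continuousCohomologyAddEquiv η hη n).toEquiv.subsingleton⟩

end Cohomology

/-! ## §5. Corollaries for `ContinuousRep.H`: restriction of scalars, change of coefficient ring -/

section ContinuousRep

variable {G : Type u} [Group G] [TopologicalSpace G] [IsTopologicalGroup G]
  {A₁ : Type u} [CommRing A₁] [TopologicalSpace A₁]
  {A₂ : Type u} [CommRing A₂] [TopologicalSpace A₂]
  {M₁ : Type u} [AddCommGroup M₁] [Module A₁ M₁] [TopologicalSpace M₁] [IsTopologicalAddGroup M₁]
  [ContinuousSMul A₁ M₁]
  {M₂ : Type u} [AddCommGroup M₂] [Module A₂ M₂] [TopologicalSpace M₂] [IsTopologicalAddGroup M₂]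
  [ContinuousSMul A₂ M₂]

/-- **`Hⁿ(G, M₁) ≃+ Hⁿ(G, M₂)` for continuous representations over two coefficient rings on modules
identified by an equivariant continuous additive equivalence** (`ContinuousRep.H` form of
`continuousCohomologyAddEquiv`). [cite: Brown1982CohomologyGroups, III.1 Example 3] -/
def ContinuousRep.HAddEquivOfContinuousAddEquiv (ρ₁ : ContinuousRep G A₁ M₁) (ρ₂ : ContinuousRep G A₂ M₂)
    (η : M₁ ≃ₜ+ M₂) (hη : ∀ (g : G) (x : M₁), η (ρ₁ g x) = ρ₂ g (η x)) (n : ℕ) :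
    ρ₁.H n ≃+ ρ₂.H n :=
  continuousCohomologyAddEquiv (X := ρ₁.toTopRep) (Y := ρ₂.toTopRep) η hη n

variable (P : Type u) [CommRing P] [TopologicalSpace P] [Algebra P A₁] [Module P M₁]
  [IsScalarTower P A₁ M₁] [ContinuousSMul P M₁]

/-- **Restriction of scalars does not change continuous cohomology, in any degree**:
`Hⁿ(G, M|_P) ≃+ Hⁿ(G, M)` (same cochains; the TODO of `ContinuousCohomologyRestrictScalars.lean`).
[cite: Brown1982CohomologyGroups, III.1 Example 3] -/
def ContinuousRep.restrictScalarsH (ρ : ContinuousRep G A₁ M₁) (n : ℕ) :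
    (ρ.restrictScalars P).H n ≃+ ρ.H n :=
  ContinuousRep.HAddEquivOfContinuousAddEquiv (ρ.restrictScalars P) ρ (ContinuousAddEquiv.refl M₁)
    (fun _ _ ↦ rfl) n

/-- Vanishing form in any degree: `Hⁿ(G, M|_P) = 0 ↔ Hⁿ(G, M) = 0` (degrees `1`, `2`:
`ContinuousRep.subsingleton_H_one_restrictScalars_iff`, `…_two_…`). [cite: Brown1982CohomologyGroups, III.1 Example 3 (the standard complex does not involve the scalars)] -/
theorem ContinuousRep.subsingleton_H_restrictScalars_iff (ρ : ContinuousRep G A₁ M₁) (n : ℕ) :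
    Subsingleton ((ρ.restrictScalars P).H n) ↔ Subsingleton (ρ.H n) :=
  ⟨fun _ ↦ (ContinuousRep.restrictScalarsH P ρ n).symm.toEquiv.subsingleton,
    fun _ ↦ (ContinuousRep.restrictScalarsH P ρ n).toEquiv.subsingleton⟩

end ContinuousRep

section Naturality

variable {k₁ : Type u} [Ring k₁] [TopologicalSpace k₁] {k₂ : Type u'} [Ring k₂] [TopologicalSpace k₂]
variable {G H : Type v} [Group G] [TopologicalSpace G] [IsTopologicalGroup G]
  [Group H] [TopologicalSpace H] [IsTopologicalGroup H]
variable {X : TopRep.{v} k₁ G} {X' : TopRep.{v} k₂ G} {Y : TopRep.{v} k₁ H} {Y' : TopRep.{v} k₂ H}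
variable (ηX : (X : Type v) ≃ₜ+ (X' : Type v)) (hηX : ∀ (g : G) (x : X), ηX (X.ρ g x) = X'.ρ g (ηX x))
variable (ηY : (Y : Type v) ≃ₜ+ (Y' : Type v)) (hηY : ∀ (h : H) (y : Y), ηY (Y.ρ h y) = Y'.ρ h (ηY y))
variable (φ : H →ₜ* G) (f : TopRep.res (φ : H →* G) X ⟶ Y) (f' : TopRep.res (φ : H →* G) X' ⟶ Y')
  (hf : ∀ x : X, ηY (f.hom x) = f'.hom (ηX x))

open TopRep ContRepresentation ContinuousCohomology

include hf in
/-- The level maps `resolutionMap φ f m` (`F ↦ f ∘ F ∘ φ`) commute with the identifications.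
[cite: SerreGaloisCohomology1997, I §2.2 (continuous homogeneous cochains, H^q = Z^q/B^q)] -/
theorem resolutionEquiv_resolutionMap : ∀ (m : ℕ) (w : (resolutionX X m : Type v)),
    resolutionEquiv ηY m ((resolutionMap φ f m).hom w) =
      (resolutionMap φ f' m).hom (resolutionEquiv ηX m w)
  | 0, w => hf w
  | m + 1, w => by
    refine ContinuousMap.ext fun x => ?_
    change resolutionEquiv ηY m ((resolutionMap φ f m).hom (w (φ x))) =
      (resolutionMap φ f' m).hom (resolutionEquiv ηX m (w (φ x)))
    exact resolutionEquiv_resolutionMap m _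

include hf in
/-- The cochain maps `cochainsMap φ f` commute with the identifications of invariant cochains.
[cite: SerreGaloisCohomology1997, I §2.2 (continuous homogeneous cochains, H^q = Z^q/B^q)] -/
theorem cochainsEquiv_cochainsMap (n : ℕ) (c : ((homogeneousCochains X).X n : Type v)) :
    cochainsEquiv ηY hηY n ((cochainsMap φ f).f n c) =
      (cochainsMap φ f').f n (cochainsEquiv ηX hηX n c) :=
  Subtype.ext (resolutionEquiv_resolutionMap ηX ηY φ f f' hf (n + 1) c.1)

include hf in
/-- **Naturality of `continuousCohomologyAddEquiv`**: the comparison isomorphisms commute with the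
maps `Hⁿ(G, X) → Hⁿ(H, Y)` induced by `φ : H →ₜ* G` and compatible coefficient morphisms `f`, `f'`
(e.g. restriction to a subgroup). [cite: Brown1982CohomologyGroups, III.1 Example 3 (the standard complex does not involve the scalars)] -/
theorem continuousCohomologyAddEquiv_map (n : ℕ) (x : continuousCohomology n X) :
    continuousCohomologyAddEquiv ηY hηY n ((ContinuousCohomology.map φ f n).hom x) =
      (ContinuousCohomology.map φ f' n).hom (continuousCohomologyAddEquiv ηX hηX n x) := by
  obtain ⟨c, hc, rfl⟩ := cxClass_surjective (homogeneousCochains X) n (n + 1) (up_nat_next n) x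
  have hc₁ : (homogeneousCochains Y).d n (n + 1) ((cochainsMap φ f).f n c) = 0 := by
    rw [hom_f_d_apply (cochainsMap φ f) n (n + 1) c, hc, map_zero]
  have hc₂ : (homogeneousCochains X').d n (n + 1) (cochainsEquiv ηX hηX n c) = 0 :=
    (mem_cocyclesAddSubgroup_iff _ n _).1
      (cocyclesEquiv (cochainsEquiv ηX hηX) (cochainsEquiv_d ηX hηX) n ⟨c, hc⟩).2
  have hc₃ : (homogeneousCochains Y').d n (n + 1) ((cochainsMap φ f').f n (cochainsEquiv ηX hηX n c)) = 0 := by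
    rw [hom_f_d_apply (cochainsMap φ f') n (n + 1), hc₂, map_zero]
  change continuousCohomologyAddEquiv ηY hηY n
      ((HomologicalComplex.homologyMap (cochainsMap φ f) n) (cxClass _ n (n + 1) (up_nat_next n) c hc)) =
    (HomologicalComplex.homologyMap (cochainsMap φ f') n)
      (continuousCohomologyAddEquiv ηX hηX n (cxClass _ n (n + 1) (up_nat_next n) c hc))
  rw [homologyMap_cxClass (cochainsMap φ f) n (n + 1) (up_nat_next n) c hc _ hc₁ rfl,
    continuousCohomologyAddEquiv_cxClass, continuousCohomologyAddEquiv_cxClass,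
    homologyMap_cxClass (cochainsMap φ f') n (n + 1) (up_nat_next n) _ hc₂ _ hc₃ rfl]
  exact cxClass_congr (cochainsEquiv_cochainsMap ηX hηX ηY hηY φ f f' hf n c)

end Naturality

section ContinuousRepNaturality

variable {G : Type u} [Group G] [TopologicalSpace G] [IsTopologicalGroup G]
  {H : Type u} [Group H] [TopologicalSpace H] [IsTopologicalGroup H]
  {A₁ : Type u} [CommRing A₁] [TopologicalSpace A₁]
  {M₁ : Type u} [AddCommGroup M₁] [Module A₁ M₁] [TopologicalSpace M₁] [IsTopologicalAddGroup M₁]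
  [ContinuousSMul A₁ M₁]
  (P : Type u) [CommRing P] [TopologicalSpace P] [Algebra P A₁] [Module P M₁]
  [IsScalarTower P A₁ M₁] [ContinuousSMul P M₁]

/-- **`restrictScalarsH` commutes with pull-back / restriction** `ContinuousRep.Hpullback` along a
continuous homomorphism `φ : H →ₜ* G`. [cite: Brown1982CohomologyGroups, III.1 Example 3 (the standard complex does not involve the scalars)] -/
theorem ContinuousRep.restrictScalarsH_Hpullback (ρ : ContinuousRep G A₁ M₁) (φ : H →ₜ* G) (n : ℕ)
    (x : (ρ.restrictScalars P).H n) :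
    ContinuousRep.restrictScalarsH P (ρ.restrict φ) n ((ρ.restrictScalars P).Hpullback φ n x) =
      ρ.Hpullback φ n (ContinuousRep.restrictScalarsH P ρ n x) :=
  continuousCohomologyAddEquiv_map (X := (ρ.restrictScalars P).toTopRep) (X' := ρ.toTopRep)
    (Y := ((ρ.restrictScalars P).restrict φ).toTopRep) (Y' := (ρ.restrict φ).toTopRep)
    (ContinuousAddEquiv.refl M₁) (fun _ _ ↦ rfl) (ContinuousAddEquiv.refl M₁) (fun _ _ ↦ rfl) φ _ _
    (fun _ ↦ rfl) n x

end ContinuousRepNaturality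

end Literature.NumberTheory.GaloisRepresentations

end
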